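import Summits.BirchSwinnertonDyer.BirchSwinnertonDyer.Theorems.AlignedTransportAtTwoMainConjectureOfRankZeroBSDAtTwoCubicLayerOneDoors
import Literature.NumberTheory.IwasawaTheory.ClassGroupPRankStableOfRankJumpLt
import HarnessLib

/-!
# Route `AlignedTransportAtTwo`, crux C2 `MainConjectureOfRankZeroBSDAtTwo` (stmt-BirchSwinnertonDyer-22298):
# THE JUMP DOORS into `MC₂(W)` for a seed-cell `W` with `Δ_W < 0` — ONE small jump of `2`-RANKS or of `2`-CLASS NUMBERS between two layers
# of the cyclotomic `ℤ₂`-tower of the cubic field `ℚ(β)` certifies `μ₂(ℚ(β)^{cyc}) = 0` (modulo PRINT⁵ + MuIneqʳ, as every door of the cell)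

HONEST FRAMING (cell `bsd-f1-sign2`, WIDTH-5 attached prover seat `bsd-line-att-p3` gen 40 on line `birth` of the lead `bsd-line-att-p2`;
`--supports` stmt-BirchSwinnertonDyer-22298, closes nothing; BSD is NOT proved by any of this; the crux C2, its verdict «blocked-on
`Rank1Residual.GreenbergMuConjectureIrreducible`» and every registered stub are untouched). THEOREMS ONLY — no definition, no named fact,
no `sorry`; every arithmetic input is a DISPLAYED hypothesis; every door is CONDITIONAL on the displayed print facts PRINT⁵ (`h17`, `hGr`, `hper`,
`hmod`, `hGZK`) and on the registered stub MuIneqʳ VERBATIM (`hI`).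

WHY. The cell's layer doors into `MC₂(W)` on the `Δ_W < 0` cell (att-p5 g25 `…CubicLayerOneDoors`: Fukuda 1994 Thm. 1 in ORDER form
`e_{n+1} = e_n` and RANK form `r_{n+1} = r_n`; att-p3 g38/g39 unit-norm-index doors; the potss one-layer criterion) all certify
`μ₂(ℚ(β)^{cyc}) = 0` from an EQUALITY of two consecutive layers or from ONE very small layer. This seat's Literature door
`ClassGroupPRankStableOfRankJumpLt` (with its algebra `FukudaRankJumpAlgebra`) replaces the equality by an INEQUALITY ON THE JUMP between ANY two
layers `n + j ≤ n + k` above Fukuda's index: `r_{n+k} + 2^j < r_{n+j} + 2^k` freezes the `2`-ranks from `n + k` and gives `μ₂ = 0`,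
`λ₂ ≤ r_{n+k}`; and since a rank jump never exceeds the jump of `e = ord₂ h` (`classGroupPRank_add_classNumberPExp_le`), the same holds with
`e_{n+k} + 2^j < e_{n+j} + 2^k`. Here both are wired into `MC₂(W)` exactly as g25's doors are (att-p5 g24 `…CubicCarrierRoad`
`mazurMainConjecture_two_of_muIneqRel_of_classicalMu_cubicField_of_Δ_neg`), in the two currencies the cell's rows carry for Fukuda's index `0`:
`2 ∤ d_{ℚ(β)}` (the `…CubicChevalleyRow…ClassNumber` files compute it) and «three primes above `2` in `ℚ(β)`» (the split stratum `Δ_W ≡ 1 (mod 8)`).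

READING FOR THE SPLIT STRATUM (all twelve certified seeds; `h(ℚ(β))` odd, `2` split, ONE real place): the ORDER doors are dead there
(`e_{n+1} ≥ e_n + 1` at EVERY layer, att-p3 g25 `…CubicTowerStrict`; g39 `…SplitStratumUnitIndexBound`), Fukuda's rank door needs
`r_{n+1} = r_n` with `n ≥ 1`, the one-layer criterion needs `r_2 ≤ 2`. The jump doors ask instead, at the pair `(1, 2)`, for
**`rank₂ Cl(F_2) ≤ rank₂ Cl(F_1) + 1`** or for **`ord₂ h(F_2) ≤ ord₂ h(F_1) + 1`** (`F_1 = ℚ(β, √2)`, `F_2 = ℚ(β)·ℚ(ζ₁₆)⁺`) — by g25's strict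
growth the latter means «the `2`-class number EXACTLY DOUBLES from `F_1` to `F_2`»; e.g. `1727a1` (`e = 0, 2, 3`, `r = 0, 2, 2`) passes BOTH,
with room on the rank side (`2 ≤ 3`).

* §1 `mazurMainConjecture_two_of_muIneqRel_of_not_dvd_discr_of_classGroupPRank_jump` /
  `…_of_not_dvd_discr_of_classNumberPExp_jump` — currency `2 ∤ d_{ℚ(β)}`; certificate: for every cyclotomic `κP` of `ℚ(β)` SOME `n, j ≤ k` with
  `r_{n+k} + 2^j < r_{n+j} + 2^k` (resp. `e_{n+k} + 2^j < e_{n+j} + 2^k`).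
* §2 `mazurMainConjecture_two_of_muIneqRel_of_threePrimes_of_classGroupPRank_jump` / `…_of_threePrimes_of_classNumberPExp_jump` — currency
  «three primes above `2`»; same certificates.  Fukuda's two g25 doors are the sub-cases `(j,k) = (0,1)` (`e_{n+1} = e_n`, resp. `r_{n+1} = r_n`).

References: [Fukuda1994] Thm. 1, p. 264; [Washington1997] §13.3 Lemma 13.18, Prop. 13.22–13.23, Thm. 13.13; [Kato2004Asterisque] Thm. 17.4;
[GreenbergLNM1716] Thm. 4.1; [Iwasawa1973MuInvariants] Thm. 2–3; tree: `…CubicCarrierRoad` §2, `…CubicLayerOneDoors` §3–§4,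
`IwasawaTheory.ClassGroupPRankStableOfRankJumpLt`, `IwasawaTheory.CyclotomicTwoTotallyRamifiedOddIndex`.
-/

-- the Theorems namespace of this sub repeats the summit name by design (D-0017 nested layout)
set_option linter.dupNamespace false
set_option autoImplicit false

noncomputable section

open scoped Classical NumberField nonZeroDivisors

namespace Summit.BirchSwinnertonDyer.BirchSwinnertonDyer.Theorems.AlignedTransportAtTwoCubicTowerJumpDoors

open NumberField IsDedekindDomain
open Literature.NumberTheory.NumberFields Literature.NumberTheory.GaloisRepresentations Literature.NumberTheory.IwasawaTheory
  Literature.NumberTheory.EllipticCurves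
  Summit.BirchSwinnertonDyer.BirchSwinnertonDyer.Theorems.AddKatoTwo
  Summit.BirchSwinnertonDyer.BirchSwinnertonDyer.Theorems.AlignedTransportAtTwoCubicLayerOneDoors

open CongruenceSubgroup WeierstrassCurve Polynomial IntermediateField
  Literature.NumberTheory.EllipticCurves.ModularForms
  Literature.NumberTheory.EllipticCurves.Rank1Residual
  Literature.NumberTheory.EllipticCurves.Greenberg1999
  Literature.NumberTheory.EllipticCurves.Module
  Summit.BirchSwinnertonDyer.Rank1Residual
  Summit.BirchSwinnertonDyer.Rank1Residual.X1.MuLambda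
  Summit.BirchSwinnertonDyer.Rank1Residual.X5
  Summit.BirchSwinnertonDyer.Rank1Residual.F1Sign2
  Summit.BirchSwinnertonDyer.BirchSwinnertonDyer.Theorems.Rank1ResidualX1Defs
  Summit.BirchSwinnertonDyer.BirchSwinnertonDyer.Theses.AlignedTransportAtTwo
  Summit.BirchSwinnertonDyer.BirchSwinnertonDyer.Theorems.AlignedTransportAtTwoCubicCarrierRoad

variable (W : WeierstrassCurve ℚ) [W.IsElliptic] [W.IsGloballyMinimal]

/-! ## §1 Currency `2 ∤ d_{ℚ(β)}` (Fukuda index `0` by `totallyRamifiedFrom_zero_of_not_dvd_discr`) -/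

/-- ★★ **THE RANK-JUMP DOOR INTO `MC₂(W)` (currency `2 ∤ d_{ℚ(β)}`).**  PRINT⁵ {Kato 17.4 (1)(2) at `2` (`h17`), Greenberg 4.1 (`hGr`), period unit
(`hper`), modularity (`hmod`), GZK (`hGZK`)} + MuIneqʳ (`hI`, the registered stub VERBATIM) + the cell hypotheses (good ordinary at `2`, no rational
`2`-torsion abscissa, `Δ_W < 0`, `r_an = 0`, even-branch `μ(L₂) = 0`, `BSD₂(W)`) + `β` a root of the `2`-division cubic with `2 ∤ d_{ℚ(β)}` + for every
cyclotomic `ℤ₂`-extension `κP` of `ℚ(β)` SOME layers `n + j ≤ n + k` with `rank₂ Cl(ℚ(β)_{n+k}) + 2^j < rank₂ Cl(ℚ(β)_{n+j}) + 2^k` ⟹ `MC₂(W)`.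
(The rank-jump door gives `μ₂(ℚ(β)^{cyc}) = 0`; then att-p5 g24's cubic-carrier road.)  Sub-cases: `(j,k) = (0,1)` is Fukuda's rank certificate
`r_{n+1} = r_n`; `(j,k) = (1,2)` reads `r_{n+2} ≤ r_{n+1} + 1`. [cite: Fukuda1994, Thm. 1 (2), p. 264] [cite: Washington1997, §13.3 Prop. 13.22–13.23]
[cite: Kato2004Asterisque, Thm. 17.4 (1)(2) (p. 273)] [cite: GreenbergLNM1716, Thm. 4.1 (p. 102) and Conj. 1.11 (p. 58)] [cite: Iwasawa1973MuInvariants, Thm. 2 and Thm. 3] -/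
theorem mazurMainConjecture_two_of_muIneqRel_of_not_dvd_discr_of_classGroupPRank_jump
    (h17 : ∀ [NeZero (W.conductorNorm ℤ)] (f : CuspForm (Gamma0 (W.conductorNorm ℤ)) 2),
      kato_divisibility_allPrimes W 2 (f := f))
    (hGr : Greenberg1999.thm41_charValue_rankZero_anyPrime)
    (hper : realPeriodRat_eq_unit_mul_plusPeriod_two) (hmod : nonempty_modularParametrizationData)
    (hGZK : rank_eq_analyticRank_of_analyticRank_le_one)
    (hI : ∀ (W : WeierstrassCurve ℚ) [W.IsElliptic] [W.IsGloballyMinimal], IsOrdinaryAt W 2 →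
      (∀ x : ℚ, ¬ HasRationalTwoTorsionX W x) →
      ∀ (κ : ZpExtension ℚ 2) (γ : Field.absoluteGaloisGroup ℚ), κ.IsCyclotomic →
      κ.IsTopGenerator γ → IsCyclotomicVariable 2 γ →
      ∀ ⦃N : ℕ⦄ [NeZero N] (f : CuspForm (Gamma0 N) 2), IsNewformOf W f →
      ∀ Gp : IwasawaAlgebra 2, iwasawaToPowerSeries 2 Gp = padicLFunction f (unitRoot W 2 : ℚ_[2]) →
      ∀ (D : W.SelmerDualData κ γ) (Yr : W.FineSelmerDualDataRelaxedInf κ γ),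
        lengthAt (IwasawaAlgebra 2) D.X ⟨IwasawaAlgebra.augIdealP 2, IwasawaAlgebra.isPrime_augIdealP_holds 2⟩ ≤
          lengthAt (IwasawaAlgebra 2) (IwasawaAlgebra 2 ⧸ Ideal.span {Gp})
              ⟨IwasawaAlgebra.augIdealP 2, IwasawaAlgebra.isPrime_augIdealP_holds 2⟩ +
            lengthAt (IwasawaAlgebra 2) Yr.X ⟨IwasawaAlgebra.augIdealP 2, IwasawaAlgebra.isPrime_augIdealP_holds 2⟩)
    (hord : IsOrdinaryAt W 2) (ht : ∀ x : ℚ, ¬ HasRationalTwoTorsionX W x) (hΔ : W.Δ < 0) (hr : W.analyticRank = 0)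
    (hμan : ∀ ⦃N : ℕ⦄ [NeZero N] (f : CuspForm (Gamma0 N) 2), IsNewformOf W f →
      ∀ G : IwasawaAlgebra 2, IsEvenBranchLiftAtTwo W f G → red G ≠ 0)
    (hbsd : BSDp W 2)
    {β : AlgebraicClosure ℚ} (hβ : aeval β W.twoTorsionPolynomial.toPoly = 0)
    (hd : haveI : FiniteDimensional ℚ ↥(IntermediateField.adjoin ℚ ({β} : Set (AlgebraicClosure ℚ))) :=
        IntermediateField.adjoin.finiteDimensional ((AlgebraicClosure.isAlgebraic ℚ).isAlgebraic β).isIntegral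
      haveI : NumberField ↥(IntermediateField.adjoin ℚ ({β} : Set (AlgebraicClosure ℚ))) := NumberField.mk
      ¬ (2 : ℤ) ∣ NumberField.discr ↥(IntermediateField.adjoin ℚ ({β} : Set (AlgebraicClosure ℚ))))
    (hcert : ∀ κP : ZpExtension ↥(IntermediateField.adjoin ℚ ({β} : Set (AlgebraicClosure ℚ))) 2, κP.IsCyclotomic →
      ∃ n j k : ℕ, j ≤ k ∧ classGroupPRank κP (n + k) + 2 ^ j < classGroupPRank κP (n + j) + 2 ^ k) :
    MazurMainConjecture W 2 := by
  have hirr := AlignedTransportAtTwoSeed.irr_two_of_forall_not_hasRationalTwoTorsionX W ht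
  have hβint : IsIntegral ℚ β := ((AlgebraicClosure.isAlgebraic ℚ).isAlgebraic β).isIntegral
  haveI : FiniteDimensional ℚ ↥(IntermediateField.adjoin ℚ ({β} : Set (AlgebraicClosure ℚ))) :=
    IntermediateField.adjoin.finiteDimensional hβint
  haveI : NumberField ↥(IntermediateField.adjoin ℚ ({β} : Set (AlgebraicClosure ℚ))) := NumberField.mk
  have h3 : Module.finrank ℚ ↥(IntermediateField.adjoin ℚ ({β} : Set (AlgebraicClosure ℚ))) = 3 :=
    AddKatoTwo.finrank_adjoin_root_twoTorsionPolynomial_eq_three W hirr hβ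
  have hodd : ¬ 2 ∣ Module.finrank ℚ ↥(IntermediateField.adjoin ℚ ({β} : Set (AlgebraicClosure ℚ))) := by rw [h3]; norm_num
  refine mazurMainConjecture_two_of_muIneqRel_of_classicalMu_cubicField_of_Δ_neg W h17 hGr hper hmod hGZK hI hord ht hΔ hr
    hμan hbsd hβ fun κP hκP => ?_
  obtain ⟨n, j, k, hjk, hjump⟩ := hcert κP hκP
  exact classicalMuVanishes_of_add_pow_lt_add_pow κP (totallyRamifiedFrom_zero_of_not_dvd_discr hodd hd κP hκP)
    (Nat.zero_le n) hjk hjump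

/-- ★★ **THE ORDER-JUMP DOOR INTO `MC₂(W)` (currency `2 ∤ d_{ℚ(β)}`).**  As the rank-jump door, with the certificate on `2`-CLASS NUMBERS: for every
cyclotomic `κP` of `ℚ(β)` SOME layers `n + j ≤ n + k` with `ord₂ h(ℚ(β)_{n+k}) + 2^j < ord₂ h(ℚ(β)_{n+j}) + 2^k` (a rank jump never exceeds an order
jump, `IwasawaTheory.classGroupPRank_add_classNumberPExp_le`).  Sub-cases: `(0,1)` is Fukuda's order certificate `e_{n+1} = e_n`; `(1,2)` reads
`e_{n+2} ≤ e_{n+1} + 1` — the `2`-class number at most doubles. [cite: Fukuda1994, Thm. 1, p. 264] [cite: Washington1997, §13.3 Prop. 13.22–13.23]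
[cite: Kato2004Asterisque, Thm. 17.4 (1)(2) (p. 273)] [cite: GreenbergLNM1716, Thm. 4.1 (p. 102) and Conj. 1.11 (p. 58)] [cite: Iwasawa1973MuInvariants, Thm. 2 and Thm. 3] -/
theorem mazurMainConjecture_two_of_muIneqRel_of_not_dvd_discr_of_classNumberPExp_jump
    (h17 : ∀ [NeZero (W.conductorNorm ℤ)] (f : CuspForm (Gamma0 (W.conductorNorm ℤ)) 2),
      kato_divisibility_allPrimes W 2 (f := f))
    (hGr : Greenberg1999.thm41_charValue_rankZero_anyPrime)
    (hper : realPeriodRat_eq_unit_mul_plusPeriod_two) (hmod : nonempty_modularParametrizationData)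
    (hGZK : rank_eq_analyticRank_of_analyticRank_le_one)
    (hI : ∀ (W : WeierstrassCurve ℚ) [W.IsElliptic] [W.IsGloballyMinimal], IsOrdinaryAt W 2 →
      (∀ x : ℚ, ¬ HasRationalTwoTorsionX W x) →
      ∀ (κ : ZpExtension ℚ 2) (γ : Field.absoluteGaloisGroup ℚ), κ.IsCyclotomic →
      κ.IsTopGenerator γ → IsCyclotomicVariable 2 γ →
      ∀ ⦃N : ℕ⦄ [NeZero N] (f : CuspForm (Gamma0 N) 2), IsNewformOf W f →
      ∀ Gp : IwasawaAlgebra 2, iwasawaToPowerSeries 2 Gp = padicLFunction f (unitRoot W 2 : ℚ_[2]) →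
      ∀ (D : W.SelmerDualData κ γ) (Yr : W.FineSelmerDualDataRelaxedInf κ γ),
        lengthAt (IwasawaAlgebra 2) D.X ⟨IwasawaAlgebra.augIdealP 2, IwasawaAlgebra.isPrime_augIdealP_holds 2⟩ ≤
          lengthAt (IwasawaAlgebra 2) (IwasawaAlgebra 2 ⧸ Ideal.span {Gp})
              ⟨IwasawaAlgebra.augIdealP 2, IwasawaAlgebra.isPrime_augIdealP_holds 2⟩ +
            lengthAt (IwasawaAlgebra 2) Yr.X ⟨IwasawaAlgebra.augIdealP 2, IwasawaAlgebra.isPrime_augIdealP_holds 2⟩)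
    (hord : IsOrdinaryAt W 2) (ht : ∀ x : ℚ, ¬ HasRationalTwoTorsionX W x) (hΔ : W.Δ < 0) (hr : W.analyticRank = 0)
    (hμan : ∀ ⦃N : ℕ⦄ [NeZero N] (f : CuspForm (Gamma0 N) 2), IsNewformOf W f →
      ∀ G : IwasawaAlgebra 2, IsEvenBranchLiftAtTwo W f G → red G ≠ 0)
    (hbsd : BSDp W 2)
    {β : AlgebraicClosure ℚ} (hβ : aeval β W.twoTorsionPolynomial.toPoly = 0)
    (hd : haveI : FiniteDimensional ℚ ↥(IntermediateField.adjoin ℚ ({β} : Set (AlgebraicClosure ℚ))) :=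
        IntermediateField.adjoin.finiteDimensional ((AlgebraicClosure.isAlgebraic ℚ).isAlgebraic β).isIntegral
      haveI : NumberField ↥(IntermediateField.adjoin ℚ ({β} : Set (AlgebraicClosure ℚ))) := NumberField.mk
      ¬ (2 : ℤ) ∣ NumberField.discr ↥(IntermediateField.adjoin ℚ ({β} : Set (AlgebraicClosure ℚ))))
    (hcert : ∀ κP : ZpExtension ↥(IntermediateField.adjoin ℚ ({β} : Set (AlgebraicClosure ℚ))) 2, κP.IsCyclotomic →
      ∃ n j k : ℕ, j ≤ k ∧ classNumberPExp κP (n + k) + 2 ^ j < classNumberPExp κP (n + j) + 2 ^ k) :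
    MazurMainConjecture W 2 := by
  have hirr := AlignedTransportAtTwoSeed.irr_two_of_forall_not_hasRationalTwoTorsionX W ht
  have hβint : IsIntegral ℚ β := ((AlgebraicClosure.isAlgebraic ℚ).isAlgebraic β).isIntegral
  haveI : FiniteDimensional ℚ ↥(IntermediateField.adjoin ℚ ({β} : Set (AlgebraicClosure ℚ))) :=
    IntermediateField.adjoin.finiteDimensional hβint
  haveI : NumberField ↥(IntermediateField.adjoin ℚ ({β} : Set (AlgebraicClosure ℚ))) := NumberField.mk
  have h3 : Module.finrank ℚ ↥(IntermediateField.adjoin ℚ ({β} : Set (AlgebraicClosure ℚ))) = 3 :=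
    AddKatoTwo.finrank_adjoin_root_twoTorsionPolynomial_eq_three W hirr hβ
  have hodd : ¬ 2 ∣ Module.finrank ℚ ↥(IntermediateField.adjoin ℚ ({β} : Set (AlgebraicClosure ℚ))) := by rw [h3]; norm_num
  refine mazurMainConjecture_two_of_muIneqRel_of_classicalMu_cubicField_of_Δ_neg W h17 hGr hper hmod hGZK hI hord ht hΔ hr
    hμan hbsd hβ fun κP hκP => ?_
  obtain ⟨n, j, k, hjk, hjump⟩ := hcert κP hκP
  exact (classGroupPRank_eq_and_classicalMuVanishes_of_classNumberPExp_add_pow_lt κP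
    (totallyRamifiedFrom_zero_of_not_dvd_discr hodd hd κP hκP) (Nat.zero_le n) hjk hjump).2.1

/-! ## §2 Currency «three primes above `2` in `ℚ(β)`» (the split stratum `Δ_W ≡ 1 (mod 8)`; Fukuda index `0` by
`forall_totallyRamifiedFrom_zero_of_three_le_ncard`) -/

/-- ★★ **THE RANK-JUMP DOOR INTO `MC₂(W)` (currency «three primes above `2`»).**  PRINT⁵ + MuIneqʳ + the cell hypotheses + `β` a root of the
`2`-division cubic + three primes above `2` in `ℚ(β)` + for every cyclotomic `κP` of `ℚ(β)` SOME layers `n + j ≤ n + k` with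
`rank₂ Cl(ℚ(β)_{n+k}) + 2^j < rank₂ Cl(ℚ(β)_{n+j}) + 2^k` ⟹ `MC₂(W)`.  att-p5 g25's rank door
`mazurMainConjecture_two_of_muIneqRel_of_threePrimes_of_classGroupPRank_succ_eq` is the sub-case `(j,k) = (0,1)`; on these seeds the first
layer pair that can fire is `(1,2)`: **`rank₂ Cl(ℚ(β,√2)·ℚ(ζ₁₆)⁺) ≤ rank₂ Cl(ℚ(β,√2)) + 1`**. [cite: Fukuda1994, Thm. 1 (2), p. 264]
[cite: Washington1997, §13.3 Prop. 13.22–13.23] [cite: Kato2004Asterisque, Thm. 17.4 (1)(2) (p. 273)]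
[cite: GreenbergLNM1716, Thm. 4.1 (p. 102) and Conj. 1.11 (p. 58)] [cite: Iwasawa1973MuInvariants, Thm. 2 and Thm. 3] -/
theorem mazurMainConjecture_two_of_muIneqRel_of_threePrimes_of_classGroupPRank_jump
    (h17 : ∀ [NeZero (W.conductorNorm ℤ)] (f : CuspForm (Gamma0 (W.conductorNorm ℤ)) 2),
      kato_divisibility_allPrimes W 2 (f := f))
    (hGr : Greenberg1999.thm41_charValue_rankZero_anyPrime)
    (hper : realPeriodRat_eq_unit_mul_plusPeriod_two) (hmod : nonempty_modularParametrizationData)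
    (hGZK : rank_eq_analyticRank_of_analyticRank_le_one)
    (hI : ∀ (W : WeierstrassCurve ℚ) [W.IsElliptic] [W.IsGloballyMinimal], IsOrdinaryAt W 2 →
      (∀ x : ℚ, ¬ HasRationalTwoTorsionX W x) →
      ∀ (κ : ZpExtension ℚ 2) (γ : Field.absoluteGaloisGroup ℚ), κ.IsCyclotomic →
      κ.IsTopGenerator γ → IsCyclotomicVariable 2 γ →
      ∀ ⦃N : ℕ⦄ [NeZero N] (f : CuspForm (Gamma0 N) 2), IsNewformOf W f →
      ∀ Gp : IwasawaAlgebra 2, iwasawaToPowerSeries 2 Gp = padicLFunction f (unitRoot W 2 : ℚ_[2]) →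
      ∀ (D : W.SelmerDualData κ γ) (Yr : W.FineSelmerDualDataRelaxedInf κ γ),
        lengthAt (IwasawaAlgebra 2) D.X ⟨IwasawaAlgebra.augIdealP 2, IwasawaAlgebra.isPrime_augIdealP_holds 2⟩ ≤
          lengthAt (IwasawaAlgebra 2) (IwasawaAlgebra 2 ⧸ Ideal.span {Gp})
              ⟨IwasawaAlgebra.augIdealP 2, IwasawaAlgebra.isPrime_augIdealP_holds 2⟩ +
            lengthAt (IwasawaAlgebra 2) Yr.X ⟨IwasawaAlgebra.augIdealP 2, IwasawaAlgebra.isPrime_augIdealP_holds 2⟩)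
    (hord : IsOrdinaryAt W 2) (ht : ∀ x : ℚ, ¬ HasRationalTwoTorsionX W x) (hΔ : W.Δ < 0) (hr : W.analyticRank = 0)
    (hμan : ∀ ⦃N : ℕ⦄ [NeZero N] (f : CuspForm (Gamma0 N) 2), IsNewformOf W f →
      ∀ G : IwasawaAlgebra 2, IsEvenBranchLiftAtTwo W f G → red G ≠ 0)
    (hbsd : BSDp W 2)
    {β : AlgebraicClosure ℚ} (hβ : aeval β W.twoTorsionPolynomial.toPoly = 0)
    (h3p : 3 ≤ {v : HeightOneSpectrum (𝓞 ↥(IntermediateField.adjoin ℚ ({β} : Set (AlgebraicClosure ℚ)))) |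
      ((2 : ℕ) : 𝓞 ↥(IntermediateField.adjoin ℚ ({β} : Set (AlgebraicClosure ℚ)))) ∈ v.asIdeal}.ncard)
    (hcert : ∀ κP : ZpExtension ↥(IntermediateField.adjoin ℚ ({β} : Set (AlgebraicClosure ℚ))) 2, κP.IsCyclotomic →
      ∃ n j k : ℕ, j ≤ k ∧ classGroupPRank κP (n + k) + 2 ^ j < classGroupPRank κP (n + j) + 2 ^ k) :
    MazurMainConjecture W 2 := by
  have hirr := AlignedTransportAtTwoSeed.irr_two_of_forall_not_hasRationalTwoTorsionX W ht
  have hβint : IsIntegral ℚ β := ((AlgebraicClosure.isAlgebraic ℚ).isAlgebraic β).isIntegral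
  haveI : FiniteDimensional ℚ ↥(IntermediateField.adjoin ℚ ({β} : Set (AlgebraicClosure ℚ))) :=
    IntermediateField.adjoin.finiteDimensional hβint
  haveI : NumberField ↥(IntermediateField.adjoin ℚ ({β} : Set (AlgebraicClosure ℚ))) := NumberField.mk
  have h3 : Module.finrank ℚ ↥(IntermediateField.adjoin ℚ ({β} : Set (AlgebraicClosure ℚ))) = 3 :=
    AddKatoTwo.finrank_adjoin_root_twoTorsionPolynomial_eq_three W hirr hβ
  refine mazurMainConjecture_two_of_muIneqRel_of_classicalMu_cubicField_of_Δ_neg W h17 hGr hper hmod hGZK hI hord ht hΔ hr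
    hμan hbsd hβ fun κP hκP => ?_
  obtain ⟨n, j, k, hjk, hjump⟩ := hcert κP hκP
  exact classicalMuVanishes_of_add_pow_lt_add_pow κP (forall_totallyRamifiedFrom_zero_of_three_le_ncard _ h3 h3p κP hκP)
    (Nat.zero_le n) hjk hjump

/-- ★★ **THE ORDER-JUMP DOOR INTO `MC₂(W)` (currency «three primes above `2`»).**  The same with the certificate on `2`-CLASS NUMBERS:
for every cyclotomic `κP` of `ℚ(β)` SOME `n + j ≤ n + k` with `ord₂ h(ℚ(β)_{n+k}) + 2^j < ord₂ h(ℚ(β)_{n+j}) + 2^k`.  att-p5 g25's ORDER door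
(`…_of_threePrimes_of_classNumberPExp_succ_eq`, certificate `e_{n+1} = e_n`) is the sub-case `(0,1)` and is VOID on these seeds (att-p3 g25:
`e_{n+1} ≥ e_n + 1` at every layer); the first pair that can fire is `(1,2)`: **`ord₂ h(ℚ(β)_2) ≤ ord₂ h(ℚ(β)_1) + 1`, i.e. the `2`-class number
EXACTLY DOUBLES from `ℚ(β,√2)` to `ℚ(β,√2)·ℚ(ζ₁₆)⁺`** (`1727a1`: `e = 0, 2, 3`). [cite: Fukuda1994, Thm. 1, p. 264]
[cite: Washington1997, §13.3 Prop. 13.22–13.23] [cite: Kato2004Asterisque, Thm. 17.4 (1)(2) (p. 273)]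
[cite: GreenbergLNM1716, Thm. 4.1 (p. 102) and Conj. 1.11 (p. 58)] [cite: Iwasawa1973MuInvariants, Thm. 2 and Thm. 3] -/
theorem mazurMainConjecture_two_of_muIneqRel_of_threePrimes_of_classNumberPExp_jump
    (h17 : ∀ [NeZero (W.conductorNorm ℤ)] (f : CuspForm (Gamma0 (W.conductorNorm ℤ)) 2),
      kato_divisibility_allPrimes W 2 (f := f))
    (hGr : Greenberg1999.thm41_charValue_rankZero_anyPrime)
    (hper : realPeriodRat_eq_unit_mul_plusPeriod_two) (hmod : nonempty_modularParametrizationData)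
    (hGZK : rank_eq_analyticRank_of_analyticRank_le_one)
    (hI : ∀ (W : WeierstrassCurve ℚ) [W.IsElliptic] [W.IsGloballyMinimal], IsOrdinaryAt W 2 →
      (∀ x : ℚ, ¬ HasRationalTwoTorsionX W x) →
      ∀ (κ : ZpExtension ℚ 2) (γ : Field.absoluteGaloisGroup ℚ), κ.IsCyclotomic →
      κ.IsTopGenerator γ → IsCyclotomicVariable 2 γ →
      ∀ ⦃N : ℕ⦄ [NeZero N] (f : CuspForm (Gamma0 N) 2), IsNewformOf W f →
      ∀ Gp : IwasawaAlgebra 2, iwasawaToPowerSeries 2 Gp = padicLFunction f (unitRoot W 2 : ℚ_[2]) →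
      ∀ (D : W.SelmerDualData κ γ) (Yr : W.FineSelmerDualDataRelaxedInf κ γ),
        lengthAt (IwasawaAlgebra 2) D.X ⟨IwasawaAlgebra.augIdealP 2, IwasawaAlgebra.isPrime_augIdealP_holds 2⟩ ≤
          lengthAt (IwasawaAlgebra 2) (IwasawaAlgebra 2 ⧸ Ideal.span {Gp})
              ⟨IwasawaAlgebra.augIdealP 2, IwasawaAlgebra.isPrime_augIdealP_holds 2⟩ +
            lengthAt (IwasawaAlgebra 2) Yr.X ⟨IwasawaAlgebra.augIdealP 2, IwasawaAlgebra.isPrime_augIdealP_holds 2⟩)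
    (hord : IsOrdinaryAt W 2) (ht : ∀ x : ℚ, ¬ HasRationalTwoTorsionX W x) (hΔ : W.Δ < 0) (hr : W.analyticRank = 0)
    (hμan : ∀ ⦃N : ℕ⦄ [NeZero N] (f : CuspForm (Gamma0 N) 2), IsNewformOf W f →
      ∀ G : IwasawaAlgebra 2, IsEvenBranchLiftAtTwo W f G → red G ≠ 0)
    (hbsd : BSDp W 2)
    {β : AlgebraicClosure ℚ} (hβ : aeval β W.twoTorsionPolynomial.toPoly = 0)
    (h3p : 3 ≤ {v : HeightOneSpectrum (𝓞 ↥(IntermediateField.adjoin ℚ ({β} : Set (AlgebraicClosure ℚ)))) |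
      ((2 : ℕ) : 𝓞 ↥(IntermediateField.adjoin ℚ ({β} : Set (AlgebraicClosure ℚ)))) ∈ v.asIdeal}.ncard)
    (hcert : ∀ κP : ZpExtension ↥(IntermediateField.adjoin ℚ ({β} : Set (AlgebraicClosure ℚ))) 2, κP.IsCyclotomic →
      ∃ n j k : ℕ, j ≤ k ∧ classNumberPExp κP (n + k) + 2 ^ j < classNumberPExp κP (n + j) + 2 ^ k) :
    MazurMainConjecture W 2 := by
  have hirr := AlignedTransportAtTwoSeed.irr_two_of_forall_not_hasRationalTwoTorsionX W ht
  have hβint : IsIntegral ℚ β := ((AlgebraicClosure.isAlgebraic ℚ).isAlgebraic β).isIntegral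
  haveI : FiniteDimensional ℚ ↥(IntermediateField.adjoin ℚ ({β} : Set (AlgebraicClosure ℚ))) :=
    IntermediateField.adjoin.finiteDimensional hβint
  haveI : NumberField ↥(IntermediateField.adjoin ℚ ({β} : Set (AlgebraicClosure ℚ))) := NumberField.mk
  have h3 : Module.finrank ℚ ↥(IntermediateField.adjoin ℚ ({β} : Set (AlgebraicClosure ℚ))) = 3 :=
    AddKatoTwo.finrank_adjoin_root_twoTorsionPolynomial_eq_three W hirr hβ
  refine mazurMainConjecture_two_of_muIneqRel_of_classicalMu_cubicField_of_Δ_neg W h17 hGr hper hmod hGZK hI hord ht hΔ hr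
    hμan hbsd hβ fun κP hκP => ?_
  obtain ⟨n, j, k, hjk, hjump⟩ := hcert κP hκP
  exact (classGroupPRank_eq_and_classicalMuVanishes_of_classNumberPExp_add_pow_lt κP
    (forall_totallyRamifiedFrom_zero_of_three_le_ncard _ h3 h3p κP hκP) (Nat.zero_le n) hjk hjump).2.1

end Summit.BirchSwinnertonDyer.BirchSwinnertonDyer.Theorems.AlignedTransportAtTwoCubicTowerJumpDoors

end
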